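import Mathlib
import Summits.ValiantsHypothesis.ValiantsHypothesis.Theorems.KPlusLogSqLawWeakLiftingTowerGraftRootSumDiscs

/-!
# Crux `WeakLifting` (stmt-ValiantsHypothesis-19561), LINE (B) `tower_graft`, letter T1 —
# MARK II OF THE SHARP INTERFACE: the bookkeeping terms `Z₊(A) + 2·Z₊(E)` removed

Helper file for LINE (B) (`Cruxes/WeakLifting/Lines/tower_graft.lean`, letters side, memo
`Cruxes/WeakLifting/Lines/tower_graft-S5.md`, T1 «log-slope localisation»), continuing
`…TowerGraftClusterDiscs` / `…TowerGraftRootSumDiscs`.  Objects as there: `A, E ∈ ℝ[X]` non-zero, the corner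
graft `h = A + X^D·E`, the residual `W = X(A′E − AE′) − D·AE`, `Z₊` = number of DISTINCT positive roots.

The sharp interface of record (`card_posRoots_add_X_pow_mul_le_of_rouche_discs`) reads
`Z₊(h) ≤ Σᵢ #{distinct roots of A·E in disc i} + Z₊(A) + 3·Z₊(E) + 1`; the kit read-outs of the line's critic
(jobs «liftp2g18-e3a» / «liftp2g18-e3m», 08-29) found that on towers about two thirds of the measured loss of this
bound against the located additive law is the bookkeeping `Z₊(A) + 2·Z₊(E)`, not the discs.  That bookkeeping came
from two crude steps of the assembly: (i) the positive zeros of `W` lying ON the roots of `A·E` were charged to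
`Z₊(A) + Z₊(E)`, (ii) the common positive roots of `h` and `E` were charged to `Z₊(E)`.  Both are removed here.

* `card_real_zeros_residual_le_card_roots_in_disc` — ONE-DISC COUNT WITH MULTIPLICITY: under the Rouché inequality on
  the circle, ANY set of real zeros of `W` in the disc (on or off the roots of `A·E`) has at most
  `#{roots of A·E in the disc, counted with multiplicity}` elements (Rouché: `W` and `−D·AE` have equally many zeros
  in the disc).  Simpler than the distinct-root count `card_real_zeros_residual_le_in_disc` and free of its off-root
  restriction.
* `card_posRoots_add_X_pow_mul_le_of_rouche_discs_sharp` — **MARK II**: discs with the Rouché inequality on their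
  circles that contain EVERY positive zero of `W` give
  `Z₊(A + X^D·E) ≤ Σᵢ #{roots of A·E in disc i, with multiplicity} + Z₊(E) + #{t > 0 : A(t) = 0 = E(t)} + 1`.
  For generic letters (simple roots, `A ⊥ E`) the multiplicity count is the distinct count and the common-root term
  vanishes, so the instrument's budget drops from `Σ + Z₊(A) + 3Z₊(E) + 1` to `Σ + Z₊(E) + 1` — against the located
  target `Z₊(A) + Z₊(E) + 1`.  (A positive zero of `W` on a root of `A·E` is exactly a positive MULTIPLE root of `A·E`,
  since `W(t) = t·A′(t)E(t)` where `A(t) = 0`; generic data have none, and any disc system built around the in-sector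
  roots contains them anyway.)
* `card_posRoots_add_X_pow_mul_le_of_rootSum_discs_sharp` — the same in ROOT-SUM language (field hypothesis
  `‖Σ_A τ/(τ−z) − Σ_E τ/(τ−z)‖ < D` on the circles, far-field hypothesis at the real zeros, coverage radius `δ(t)·t ≥ 0`),
  the one-call form the kit instrument prices.
* `card_posRoots_add_X_pow_mul_le_of_discs_sharp` — the same under the CLEARANCE + COVERAGE packaging of the statement of
  record (`0 < s ≤ 1`, `0 < D`, `4(deg A + deg E) ≤ s·D`): `≤ Σᵢ Nᵢ + Z₊(E) + #common + 1` in place of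
  `2·Σᵢ #distinct + 2·Z₊(E) + 1`.

Proof: the scalar Rolle–Schur count (`RolleSchur.posRoots_le_scalar`) gives
`Z₊(h) ≤ Z₊(W) + Z₊(E) + 1 + #{t > 0 : h(t) = 0 = E(t)}`; the last set equals the common positive roots of `A` and `E`
(`h(t) = A(t) + t^D E(t)`); every positive zero of `W` lies in a disc, and inside disc `i` there are at most `Nᵢ` of them
by the multiplicity count.  Mathlib + the line's earlier helper files only; axioms `propext`, `Classical.choice`,
`Quot.sound`; no `sorry`; no definitions, no named facts.

Honest framing: a `--supports` helper for a registered LINE of the V2 crux; it sharpens the CONSTANT of the T1 interface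
(instrument / structure tier) and proves nothing about `stub_graftLawCorner`, `stub_oneLetterGraftLaw`, `WeakLifting`,
Conjecture B (`KPlusLogSqLaw`) or `LacunarySymmetroid`; `VP ≠ VNP` is NOT proved and nothing here is progress on it.
-/

-- `Summit.ValiantsHypothesis.ValiantsHypothesis.…` repeats a component by the D-0017 layout
-- (single-conjunct summit), which the `dupNamespace` linter flags; the name is mandated.
set_option linter.dupNamespace false

namespace Summit.ValiantsHypothesis.ValiantsHypothesis.Theorems.KPlusLogSqLaw.TowerGraft

open Polynomial Complex
open scoped BigOperators Polynomial Real

section SharpCount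

/-- **ONE-DISC COUNT WITH MULTIPLICITY.**  Let `A, E ∈ ℝ[X]` be non-zero and `W = X(A′E − AE′) − D·AE`.  If on the circle
`|τ − c| = R` (`R > 0`) the complexified residual satisfies the Rouché inequality `‖W(τ) + D·A(τ)E(τ)‖ < ‖D·A(τ)E(τ)‖`, then
any finite set of real zeros of `W` inside the disc has at most `#{roots of A·E in the disc, with multiplicity}` elements
(the inequality forces `D ≠ 0` and `W ≢ 0`; `A, E ≠ 0` is not needed as a hypothesis). [this work] -/
theorem card_real_zeros_residual_le_card_roots_in_disc (A E : ℝ[X]) (D : ℕ) (c : ℂ) {R : ℝ} (hR : 0 < R)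
    (hbd : ∀ τ ∈ Metric.sphere c R,
      ‖((X * (derivative A * E - A * derivative E) - C (D : ℝ) * (A * E)).map Complex.ofRealHom +
          C (D : ℂ) * ((A * E).map Complex.ofRealHom)).eval τ‖ <
        ‖(C (D : ℂ) * ((A * E).map Complex.ofRealHom)).eval τ‖)
    (T : Finset ℝ) (hT : ∀ t ∈ T, dist (t : ℂ) c < R ∧
      (X * (derivative A * E - A * derivative E) - C (D : ℝ) * (A * E)).eval t = 0) :
    T.card ≤ Multiset.card ((((A * E).map Complex.ofRealHom).roots.filter fun z => dist z c < R)) := by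
  classical
  set W : ℝ[X] := X * (derivative A * E - A * derivative E) - C (D : ℝ) * (A * E) with hW
  set Wc : ℂ[X] := W.map Complex.ofRealHom with hWc
  set Fc : ℂ[X] := (A * E).map Complex.ofRealHom with hFc
  have hD0 : (D : ℂ) ≠ 0 := by
    intro hD
    obtain ⟨τ, hτ⟩ : (Metric.sphere c R).Nonempty := (NormedSpace.sphere_nonempty).mpr hR.le
    have := hbd τ hτ
    rw [hD, map_zero, zero_mul, add_zero, eval_zero, norm_zero] at this
    exact absurd this (not_lt.mpr (norm_nonneg _))
  -- Rouché against `−D·A·E`: root counts of `Wc` and `Fc` in the disc agree (with multiplicity)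
  have hrouche := card_roots_filter_ball_eq_of_norm_lt (-(C (D : ℂ) * Fc)) (Wc + C (D : ℂ) * Fc) c hR (by
    intro τ hτ
    rw [eval_neg, norm_neg]
    exact hbd τ hτ)
  rw [show -(C (D : ℂ) * Fc) + (Wc + C (D : ℂ) * Fc) = Wc by ring, Polynomial.roots_neg, roots_C_mul _ hD0] at hrouche
  have hWc0 : Wc ≠ 0 := by
    intro h0
    obtain ⟨τ, hτ⟩ : (Metric.sphere c R).Nonempty := (NormedSpace.sphere_nonempty).mpr hR.le
    have := hbd τ hτ
    rw [h0, zero_add] at this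
    exact lt_irrefl _ this
  have hev : ∀ x : ℝ, Wc.eval (x : ℂ) = ((W.eval x : ℝ) : ℂ) := fun x => by
    rw [hWc, Polynomial.eval_map, ← Complex.ofRealHom_eq_coe, Polynomial.eval₂_at_apply, Complex.ofRealHom_eq_coe]
  -- the lifted real zeros sit among the roots of `Wc` in the disc
  set T' : Finset ℂ := T.image fun t : ℝ => (t : ℂ) with hT'
  have hsub : T' ⊆ (Wc.roots.filter fun z => dist z c < R).toFinset := by
    intro x hx
    rw [hT', Finset.mem_image] at hx
    obtain ⟨t, ht, rfl⟩ := hx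
    obtain ⟨hdist, hWt⟩ := hT t ht
    rw [Multiset.mem_toFinset, Multiset.mem_filter, Polynomial.mem_roots hWc0, Polynomial.IsRoot.def, hev, hWt,
      Complex.ofReal_zero]
    exact ⟨rfl, hdist⟩
  calc T.card = T'.card := (Finset.card_image_of_injective _ Complex.ofReal_injective).symm
    _ ≤ (Wc.roots.filter fun z => dist z c < R).toFinset.card := Finset.card_le_card hsub
    _ ≤ Multiset.card (Wc.roots.filter fun z => dist z c < R) := Multiset.toFinset_card_le _
    _ = Multiset.card (Fc.roots.filter fun z => dist z c < R) := hrouche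

/-- **T1, SHARP INTERFACE — MARK II.**  `A, E ∈ ℝ[X]`, `A ≠ 0` (for `E = 0` everything is vacuous or trivial); discs `B(ctr i, rad i)` on whose circles the Rouché
inequality `‖W + D·AE‖ < ‖D·AE‖` holds (e.g. via `rouche_ineq_of_rootSum_norm_lt`), and which contain EVERY positive zero of
the residual `W = X(A′E − AE′) − D·AE`.  Then
`Z₊(A + X^D·E) ≤ Σᵢ #{roots of A·E in disc i, with multiplicity} + Z₊(E) + #{t > 0 : A(t) = 0 ∧ E(t) = 0} + 1`.
(The positive zeros of `W` on the roots of `A·E` are exactly the positive multiple roots of `A·E`; for letters with simple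
roots and `A ⊥ E` the bound reads `Σᵢ #distinct + Z₊(E) + 1`.) [this work] -/
theorem card_posRoots_add_X_pow_mul_le_of_rouche_discs_sharp (A E : ℝ[X]) (D : ℕ) (hA : A ≠ 0)
    {ι : Type*} (I : Finset ι) (ctr : ι → ℂ) (rad : ι → ℝ) (hrad : ∀ i ∈ I, 0 < rad i)
    (hbd : ∀ i ∈ I, ∀ τ ∈ Metric.sphere (ctr i) (rad i),
      ‖((X * (derivative A * E - A * derivative E) - C (D : ℝ) * (A * E)).map Complex.ofRealHom +
          C (D : ℂ) * ((A * E).map Complex.ofRealHom)).eval τ‖ <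
        ‖(C (D : ℂ) * ((A * E).map Complex.ofRealHom)).eval τ‖)
    (hcovW : ∀ t : ℝ, 0 < t →
      (X * (derivative A * E - A * derivative E) - C (D : ℝ) * (A * E)).eval t = 0 → ∃ i ∈ I, dist (t : ℂ) (ctr i) < rad i) :
    ((A + X ^ D * E).roots.toFinset.filter (fun t => 0 < t)).card ≤
      ∑ i ∈ I, Multiset.card ((((A * E).map Complex.ofRealHom).roots.filter fun z => dist z (ctr i) < rad i)) +
        (E.roots.toFinset.filter (fun t => 0 < t)).card +
        (A.roots.toFinset.filter (fun t => 0 < t ∧ E.IsRoot t)).card + 1 := by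
  classical
  by_cases hh0 : A + X ^ D * E = 0
  · rw [hh0, Polynomial.roots_zero]; simp
  have hRS := LacunarySymmetroidMatrixDescartes.RolleSchur.posRoots_le_scalar (A + X ^ D * E) E (D : ℝ) hh0
  rw [residual_graft_eq] at hRS
  set W : ℝ[X] := X * (derivative A * E - A * derivative E) - C (D : ℝ) * (A * E) with hW
  -- the common positive roots of `h` and `E` are the common positive roots of `A` and `E`
  have hcommon : ((A + X ^ D * E).roots.toFinset.filter (fun x => 0 < x ∧ E.IsRoot x)).card ≤
      (A.roots.toFinset.filter (fun t => 0 < t ∧ E.IsRoot t)).card := by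
    refine Finset.card_le_card fun t ht => ?_
    rw [Finset.mem_filter, Multiset.mem_toFinset, Polynomial.mem_roots hh0] at ht
    obtain ⟨hht, hpos, hEt⟩ := ht
    rw [Finset.mem_filter, Multiset.mem_toFinset, Polynomial.mem_roots hA]
    refine ⟨?_, hpos, hEt⟩
    have hE0 : E.eval t = 0 := hEt
    have hh := hht.eq_zero
    rw [eval_add, eval_mul, eval_pow, eval_X, hE0, mul_zero, add_zero] at hh
    exact hh
  -- every positive zero of `W` lies in a disc; inside disc `i` there are at most `Nᵢ` of them
  set ZW := W.roots.toFinset.filter (fun x => 0 < x) with hZW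
  have hZWle : ZW.card ≤
      ∑ i ∈ I, Multiset.card ((((A * E).map Complex.ofRealHom).roots.filter fun z => dist z (ctr i) < rad i)) := by
    have hmem : ∀ t ∈ ZW, 0 < t ∧ W.eval t = 0 := by
      intro t ht
      rw [hZW, Finset.mem_filter, Multiset.mem_toFinset] at ht
      exact ⟨ht.2, (Polynomial.mem_roots'.mp ht.1).2⟩
    have hsub : ZW ⊆ I.biUnion fun i => ZW.filter fun t => dist (t : ℂ) (ctr i) < rad i := by
      intro t ht
      obtain ⟨hpos, hWt⟩ := hmem t ht
      obtain ⟨i, hi, hd⟩ := hcovW t hpos hWt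
      exact Finset.mem_biUnion.mpr ⟨i, hi, Finset.mem_filter.mpr ⟨ht, hd⟩⟩
    refine (Finset.card_le_card hsub).trans (Finset.card_biUnion_le.trans (Finset.sum_le_sum fun i hi => ?_))
    refine card_real_zeros_residual_le_card_roots_in_disc A E D (ctr i) (hrad i hi) (hbd i hi) _ (fun t ht => ?_)
    rw [Finset.mem_filter] at ht
    exact ⟨ht.2, (hmem t ht.1).2⟩
  omega

/-- **MARK II IN ROOT-SUM LANGUAGE** (the one-call form the kit instrument prices).  `A, E ∈ ℝ[X]` non-zero, `0 < D`, discs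
`B(ctr i, rad i)`, a coverage scale `δ(t) ≥ 0`: if (field) on every circle `A, E ≠ 0` and `‖Σ_A τ/(τ−z) − Σ_E τ/(τ−z)‖ < D`,
(far field) at every positive real zero candidate `t` off the roots the roots farther than `δ(t)·t` carry
`Σ ‖t/(t−z)‖ ≤ D/2`, and (coverage) every positive `t` within `δ(t)·t` of a root of `A·E` lies in a disc, then
`Z₊(A + X^D·E) ≤ Σᵢ #{roots of A·E in disc i, with multiplicity} + Z₊(E) + #{t > 0 : A(t) = 0 ∧ E(t) = 0} + 1`. [this work] -/
theorem card_posRoots_add_X_pow_mul_le_of_rootSum_discs_sharp (A E : ℝ[X]) {D : ℕ} (hD : 0 < D) (hA : A ≠ 0) (hE : E ≠ 0)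
    {ι : Type*} (I : Finset ι) (ctr : ι → ℂ) (rad : ι → ℝ) (hrad : ∀ i ∈ I, 0 < rad i) (δ : ℝ → ℝ)
    (hδ : ∀ t : ℝ, 0 < t → 0 ≤ δ t)
    (hfield : ∀ i ∈ I, ∀ τ ∈ Metric.sphere (ctr i) (rad i),
      (A.map Complex.ofRealHom).eval τ ≠ 0 ∧ (E.map Complex.ofRealHom).eval τ ≠ 0 ∧
      ‖((A.map Complex.ofRealHom).roots.map fun z => τ / (τ - z)).sum -
        ((E.map Complex.ofRealHom).roots.map fun z => τ / (τ - z)).sum‖ < D)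
    (hfar : ∀ t : ℝ, 0 < t → A.eval t ≠ 0 → E.eval t ≠ 0 →
      ((((A.map Complex.ofRealHom).roots + (E.map Complex.ofRealHom).roots).filter
        (fun z => δ t * t < ‖(t : ℂ) - z‖)).map (fun z => ‖(t : ℂ) / ((t : ℂ) - z)‖)).sum ≤ (D : ℝ) / 2)
    (hcover : ∀ t : ℝ, 0 < t → ∀ z ∈ (A.map Complex.ofRealHom).roots + (E.map Complex.ofRealHom).roots,
      ‖(t : ℂ) - z‖ ≤ δ t * t → ∃ i ∈ I, dist (t : ℂ) (ctr i) < rad i) :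
    ((A + X ^ D * E).roots.toFinset.filter (fun t => 0 < t)).card ≤
      ∑ i ∈ I, Multiset.card ((((A * E).map Complex.ofRealHom).roots.filter fun z => dist z (ctr i) < rad i)) +
        (E.roots.toFinset.filter (fun t => 0 < t)).card +
        (A.roots.toFinset.filter (fun t => 0 < t ∧ E.IsRoot t)).card + 1 := by
  have hAc0 : A.map Complex.ofRealHom ≠ 0 := (Polynomial.map_ne_zero_iff Complex.ofRealHom.injective).mpr hA
  have hEc0 : E.map Complex.ofRealHom ≠ 0 := (Polynomial.map_ne_zero_iff Complex.ofRealHom.injective).mpr hE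
  have hev : ∀ (Q : ℝ[X]) (x : ℝ), (Q.map Complex.ofRealHom).eval (x : ℂ) = ((Q.eval x : ℝ) : ℂ) := fun Q x => by
    rw [Polynomial.eval_map, ← Complex.ofRealHom_eq_coe, Polynomial.eval₂_at_apply, Complex.ofRealHom_eq_coe]
  refine card_posRoots_add_X_pow_mul_le_of_rouche_discs_sharp A E D hA I ctr rad hrad (fun i hi τ hτ => ?_)
    (fun t ht hWt => ?_)
  · obtain ⟨hAτ, hEτ, hsum⟩ := hfield i hi τ hτ
    exact rouche_ineq_of_rootSum_norm_lt A E D hAτ hEτ hsum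
  · by_cases hAE : A.eval t = 0 ∨ E.eval t = 0
    · -- `t` is itself a root of `A·E`: covered with `z = t`
      have htZ : (t : ℂ) ∈ (A.map Complex.ofRealHom).roots + (E.map Complex.ofRealHom).roots := by
        rw [Multiset.mem_add]
        rcases hAE with h | h
        · left; rw [Polynomial.mem_roots hAc0, Polynomial.IsRoot.def, hev, h, Complex.ofReal_zero]
        · right; rw [Polynomial.mem_roots hEc0, Polynomial.IsRoot.def, hev, h, Complex.ofReal_zero]
      exact hcover t ht (t : ℂ) htZ (by rw [sub_self, norm_zero]; exact mul_nonneg (hδ t ht) ht.le)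
    · push Not at hAE
      obtain ⟨z, hz, hclose⟩ :=
        exists_root_near_of_residual_zero_of_farField A E hD hAE.1 hAE.2 hWt (hfar t ht hAE.1 hAE.2)
      exact hcover t ht z hz hclose

/-- **MARK II OF THE STATEMENT OF RECORD (clearance + coverage packaging).**  `A, E ∈ ℝ[X]` non-zero, `0 < s ≤ 1`, `0 < D`,
`4(deg A + deg E) ≤ s·D`; discs `B(ctr i, rad i)` (`rad i > 0`, circles avoiding `0`) with CLEARANCE (every complex root `z` of
`A·E` is `≥ 4((deg A + deg E)/D)·‖z‖` away from every circle) and COVERAGE (every real `t > 0` within `4((deg A + deg E)/D)·‖z‖`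
of an in-sector root `z` lies in some disc).  Then
`Z₊(A + X^D·E) ≤ Σᵢ #{roots of A·E in disc i, with multiplicity} + Z₊(E) + #{t > 0 : A(t) = 0 ∧ E(t) = 0} + 1`
(in place of `2·Σᵢ #distinct + 2·Z₊(E) + 1`). [this work] -/
theorem card_posRoots_add_X_pow_mul_le_of_discs_sharp {s : ℝ} (hs : 0 < s) (hs1 : s ≤ 1) (A E : ℝ[X]) {D : ℕ} (hD : 0 < D)
    (hA : A ≠ 0) (hE : E ≠ 0) (hdeg : 4 * ((A.natDegree : ℝ) + E.natDegree) ≤ s * D)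
    {ι : Type*} (I : Finset ι) (ctr : ι → ℂ) (rad : ι → ℝ) (hrad : ∀ i ∈ I, 0 < rad i)
    (h0 : ∀ i ∈ I, ∀ τ ∈ Metric.sphere (ctr i) (rad i), τ ≠ 0)
    (hclear : ∀ i ∈ I, ∀ τ ∈ Metric.sphere (ctr i) (rad i),
      ∀ z ∈ (A.map Complex.ofRealHom).roots + (E.map Complex.ofRealHom).roots,
        4 * (((A.natDegree : ℝ) + E.natDegree) / D) * ‖z‖ ≤ ‖τ - z‖)
    (hcover : ∀ z ∈ (A.map Complex.ofRealHom).roots + (E.map Complex.ofRealHom).roots,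
      ¬ (s * ‖z‖ ≤ |z.im| ∨ z.re ≤ 0) → ∀ t : ℝ, 0 < t →
        ‖(t : ℂ) - z‖ ≤ 4 * (((A.natDegree : ℝ) + E.natDegree) / D) * ‖z‖ → ∃ i ∈ I, dist (t : ℂ) (ctr i) < rad i) :
    ((A + X ^ D * E).roots.toFinset.filter (fun t => 0 < t)).card ≤
      ∑ i ∈ I, Multiset.card ((((A * E).map Complex.ofRealHom).roots.filter fun z => dist z (ctr i) < rad i)) +
        (E.roots.toFinset.filter (fun t => 0 < t)).card +
        (A.roots.toFinset.filter (fun t => 0 < t ∧ E.IsRoot t)).card + 1 := by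
  classical
  set n : ℝ := (A.natDegree : ℝ) + E.natDegree with hn
  set ρ : ℝ := n / D with hρ
  have hD0 : (0 : ℝ) < D := by exact_mod_cast hD
  have hnD : 4 * n ≤ D := le_trans hdeg (by nlinarith)
  have hρle : ρ ≤ 1 / 4 := by rw [hρ, div_le_iff₀ hD0]; linarith
  have hρ0 : 0 ≤ ρ := by positivity
  have hAc0 : A.map Complex.ofRealHom ≠ 0 := (Polynomial.map_ne_zero_iff Complex.ofRealHom.injective).mpr hA
  have hEc0 : E.map Complex.ofRealHom ≠ 0 := (Polynomial.map_ne_zero_iff Complex.ofRealHom.injective).mpr hE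
  have hev : ∀ (Q : ℝ[X]) (x : ℝ), (Q.map Complex.ofRealHom).eval (x : ℂ) = ((Q.eval x : ℝ) : ℂ) := fun Q x => by
    rw [Polynomial.eval_map, ← Complex.ofRealHom_eq_coe, Polynomial.eval₂_at_apply, Complex.ofRealHom_eq_coe]
  refine card_posRoots_add_X_pow_mul_le_of_rouche_discs_sharp A E D hA I ctr rad hrad (fun i hi τ hτ => ?_)
    (fun t ht hWt => ?_)
  · exact rouche_ineq_of_clearance A E hA hE hD hnD (h0 i hi τ hτ) (hclear i hi τ hτ)
  · by_cases hAE : A.eval t = 0 ∨ E.eval t = 0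
    · -- `t` is itself an in-sector root of `A·E`: covered with `z = t`
      have htZ : (t : ℂ) ∈ (A.map Complex.ofRealHom).roots + (E.map Complex.ofRealHom).roots := by
        rw [Multiset.mem_add]
        rcases hAE with h | h
        · left; rw [Polynomial.mem_roots hAc0, Polynomial.IsRoot.def, hev, h, Complex.ofReal_zero]
        · right; rw [Polynomial.mem_roots hEc0, Polynomial.IsRoot.def, hev, h, Complex.ofReal_zero]
      exact hcover (t : ℂ) htZ (not_offSector_of_pos hs ht) t ht (by rw [sub_self, norm_zero]; positivity)
    · push Not at hAE
      obtain ⟨z, hz, hzin, hclose⟩ :=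
        exists_inSector_root_near_of_residual_zero hs hs1 A E hD hdeg ht hAE.1 hAE.2 hWt
      refine hcover z hz hzin t ht ?_
      -- `‖t − z‖ ≤ 2ρ t` and `t ≤ ‖z‖ + ‖t − z‖` give `‖t − z‖ ≤ 4ρ‖z‖` (ρ ≤ 1/4)
      have htz : (t : ℝ) ≤ ‖z‖ + ‖(t : ℂ) - z‖ := by
        have := norm_le_norm_add_norm_sub' (t : ℂ) z
        rw [Complex.norm_real, Real.norm_eq_abs, abs_of_pos ht] at this
        linarith [norm_sub_rev (t : ℂ) z]
      have h2 : ‖(t : ℂ) - z‖ ≤ 2 * ρ * t := by rw [hρ]; linarith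
      nlinarith [norm_nonneg ((t : ℂ) - z), norm_nonneg z]

end SharpCount

end Summit.ValiantsHypothesis.ValiantsHypothesis.Theorems.KPlusLogSqLaw.TowerGraft
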